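import Summits.ABC.StewartYu.YuNinetyW80Transfer
import HarnessLib

/-!
# The odd-prime transfer to the Waldschmidt-shape text, constant WRITTEN OUT (papers lane ABC-P1, writer seat; theorems only)

`Summits/ABC/ABC/Theorems/AbcExplicitW80TransferOdd.lean`.  The cell's transfer
`Summit.ABC.StewartYu.YuNinetyW80.residueClass_of_w80Engine` (`YuNinetyW80Transfer.lean`) takes an `∃ (C) (c₁)`-packaged
engine and returns the `∃ c₅`-packaged rational-prime text; its proof sets `c₅ := 41·c₁`.  This file re-runs it
VERBATIM with both existentials opened:

* `YuNinetyW80.residueClass_of_w80Engine_explicit` — for a residue predicate `P` with `¬ P 2`, an engine at the `P`-primes with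
  a GIVEN constant function `C` and envelope `0 ≤ C m ≤ c₁^m m^m` (`m ≥ 1`, `1 ≤ c₁`) yields, at every prime with `P p`,
  `ord_p(∏_{q∈S} q^{e_q} − 1) < (41c₁ · #S)^{#S} · p² · (log B + log log A) · log log A · ∏ log max(4,q)` (`A = max(4, max S)`),
  with `41·c₁` in the statement (book-keeping `αⱼ = qⱼ`, `Vⱼ = log p·log max(4,qⱼ)`, `W = log B·log p`, `(log p)² ≤ 4p`,
  unchanged).

No new definition; [folklore] bookkeeping.  WHAT THIS IS NOT: no engine is proved here.
-/

noncomputable section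

open Finset Real Height

namespace Summit.ABC.StewartYu

namespace YuNinetyW80

open Summit.ABC.ABC.Theorems

/-- **Generic residue-class transfer, Waldschmidt-shape engine, explicit constant** `c₅ = 41c₁`: for a predicate `P` on
primes with `¬ P 2`, an engine bound `ord_p(∏ αⱼ^{bⱼ} − 1) ≤ C(m)·p·∏(Vⱼ/log p)·(W + log 2Vmax)·log 2Vmax` at every prime
with `P p`, for a given `C` with `0 ≤ C(m) ≤ c₁^m m^m` (`m ≥ 1`), gives at every prime with `P p` the rational-prime text
`ord_p(∏_{q∈S} q^{e_q} − 1) < (41c₁ #S)^{#S}·p²·(log B + log log A)·log log A·∏ log max(4,q)` — the body of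
`residueClass_of_w80Engine` verbatim. [folklore] -/
theorem residueClass_of_w80Engine_explicit (P : ℕ → Prop) (hP2 : ¬ P 2) {C : ℕ → ℝ} {c₁ : ℝ} (hc₁ : 1 ≤ c₁)
    (hC : ∀ m, 1 ≤ m → 0 ≤ C m ∧ C m ≤ c₁ ^ m * (m : ℝ) ^ m)
    (hA : ∀ (p : ℕ), p.Prime → P p → ∀ (m : ℕ) (α : Fin m → ℚ) (b : Fin m → ℤ) (V : Fin m → ℝ)
        (Vmax W : ℝ),
        (∀ j, α j ≠ 0 ∧ padicValRat p (α j) = 0) →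
        (∀ μ : Fin m → ℤ, ∏ j, α j ^ μ j = 1 → μ = 0) →
        (∀ T : Finset (Fin m), T.Nonempty → ¬ IsSquare (∏ j ∈ T, α j) ∧ ¬ IsSquare (-∏ j ∈ T, α j)) →
        (∀ j, Height.logHeight₁ (α j) ≤ V j) → (∀ j, Real.log p ≤ V j) → (∀ j, V j ≤ Vmax) →
        b ≠ 0 → (∀ j, Real.log (max 3 (|b j| : ℝ)) ≤ W) → Real.log p ≤ W →
        (padicValRat p (∏ j, α j ^ b j - 1) : ℝ) ≤
          C m * p * (∏ j, V j / Real.log p) * (W + Real.log (2 * Vmax)) * Real.log (2 * Vmax)) :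
    ∀ (p : ℕ), p.Prime → P p → ∀ (S : Finset ℕ), (∀ q ∈ S, q.Prime) → p ∉ S →
      S.Nonempty → ∀ (e : ℕ → ℤ) (B : ℝ), 3 ≤ B → (∀ q ∈ S, (|e q| : ℝ) ≤ B) →
      ∏ q ∈ S, (q : ℚ) ^ e q ≠ 1 →
      (padicValRat p (∏ q ∈ S, (q : ℚ) ^ e q - 1) : ℝ) <
        (41 * c₁ * S.card) ^ S.card * (p : ℝ) ^ 2 *
          ((Real.log B + Real.log (Real.log ((max 4 (S.sup id) : ℕ) : ℝ))) *
            Real.log (Real.log ((max 4 (S.sup id) : ℕ) : ℝ))) *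
          ∏ q ∈ S, Real.log ((max 4 q : ℕ) : ℝ) := by
  classical
  intro p hp hPp S hS hpS hSne e B hB heB hne1
  have hp2 : p ≠ 2 := fun h => hP2 (h ▸ hPp)
  haveI := Fact.mk hp
  -- enumeration of `S`
  set m : ℕ := S.card with hm
  have hm1 : 1 ≤ m := Finset.card_pos.mpr hSne
  set φ : Fin m ≃ S := S.equivFin.symm with hφ
  set q : Fin m → ℕ := fun i => (φ i : ℕ) with hqdef
  have hqS : ∀ i, q i ∈ S := fun i => (φ i).2
  have hqP : ∀ i, (q i).Prime := fun i => hS _ (hqS i)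
  have hinj : Function.Injective q := fun i j hij => φ.injective (Subtype.ext hij)
  have hqp : ∀ i, q i ≠ p := fun i h => hpS (h ▸ hqS i)
  have hreidx : ∀ {M : Type} [CommMonoid M] (f : ℕ → M), ∏ i, f (q i) = ∏ x ∈ S, f x := by
    intro M _ f
    rw [← Finset.prod_coe_sort S f]
    exact Fintype.prod_equiv φ (fun i => f (q i)) (fun x => f x) (fun i => rfl)
  -- the data fed to the engine
  set L : ℝ := Real.log p with hL
  set M4 : ℝ := ((max 4 (S.sup id) : ℕ) : ℝ) with hM4
  set X : ℝ := Real.log M4 with hX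
  set α : Fin m → ℚ := fun j => (q j : ℚ) with hα
  set b : Fin m → ℤ := fun j => e (q j) with hb
  set V : Fin m → ℝ := fun j => L * Real.log ((max 4 (q j) : ℕ) : ℝ) with hV
  set Vmax : ℝ := L * X with hVmax
  set W : ℝ := Real.log B * L with hW
  -- numerics of `p ≥ 3`
  have hp3 : 3 ≤ p := by have := hp.two_le; omega
  have hp3R : (3 : ℝ) ≤ p := by exact_mod_cast hp3
  have hpR0 : (0 : ℝ) < p := by linarith
  have hL1 : 1 < L := by
    have h3 : (1 : ℝ) < Real.log 3 := by
      rw [Real.lt_log_iff_exp_lt (by norm_num)]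
      exact Real.exp_one_lt_d9.trans (by norm_num)
    exact h3.trans_le (Real.log_le_log (by norm_num) hp3R)
  have hL0 : 0 < L := by linarith
  have hX1 : (1.38 : ℝ) ≤ X := (loglog_max_four_bounds (S.sup id)).1
  have hℓ : (0.27 : ℝ) ≤ Real.log X := (loglog_max_four_bounds (S.sup id)).2
  have hX0 : 0 < X := by linarith
  have hlogmax : ∀ j, (1.38 : ℝ) ≤ Real.log ((max 4 (q j) : ℕ) : ℝ) := fun j =>
    (loglog_max_four_bounds (q j)).1
  -- the engine's hypotheses
  have h1 : ∀ j, α j ≠ 0 ∧ padicValRat p (α j) = 0 := fun j =>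
    ⟨by simp only [hα]; exact_mod_cast (hqP j).ne_zero,
      Literature.Barriers.ABC.StewartTijdemanGeneric.padicValRat_natCast_prime_of_ne hp (hqP j) (hqp j)⟩
  have h2 : ∀ μ : Fin m → ℤ, ∏ j, α j ^ μ j = 1 → μ = 0 := fun μ hμ =>
    Literature.Barriers.ABC.StewartTijdemanGeneric.prime_family_zpow_eq_one hqP hinj hμ
  have h3 : ∀ T : Finset (Fin m), T.Nonempty →
      ¬ IsSquare (∏ j ∈ T, α j) ∧ ¬ IsSquare (-∏ j ∈ T, α j) := fun T hT =>
    not_isSquare_prod_distinct_primes q hqP hinj T hT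
  have h4 : ∀ j, logHeight₁ (α j) ≤ V j := by
    intro j
    haveI : NeZero (q j) := ⟨(hqP j).ne_zero⟩
    have hh : logHeight₁ (α j) = Real.log (q j) := by
      simp only [hα]; exact Rat.logHeight₁_natCast (q j)
    rw [hh]
    have hq4 : Real.log (q j) ≤ Real.log ((max 4 (q j) : ℕ) : ℝ) :=
      Real.log_le_log (by exact_mod_cast (hqP j).pos) (by exact_mod_cast le_max_right 4 (q j))
    calc Real.log (q j) ≤ Real.log ((max 4 (q j) : ℕ) : ℝ) := hq4
      _ ≤ L * Real.log ((max 4 (q j) : ℕ) : ℝ) :=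
          le_mul_of_one_le_left (by linarith [hlogmax j]) hL1.le
  have h5 : ∀ j, Real.log p ≤ V j := fun j => by
    show L ≤ L * Real.log ((max 4 (q j) : ℕ) : ℝ)
    exact le_mul_of_one_le_right hL0.le (by linarith [hlogmax j])
  have h6 : ∀ j, V j ≤ Vmax := by
    intro j
    have hle : ((max 4 (q j) : ℕ) : ℝ) ≤ M4 := by
      rw [hM4]
      exact_mod_cast max_le_max le_rfl (Finset.le_sup (f := id) (hqS j))
    have hpos : (0 : ℝ) < ((max 4 (q j) : ℕ) : ℝ) := by
      exact_mod_cast lt_of_lt_of_le (by norm_num) (le_max_left 4 (q j))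
    exact mul_le_mul_of_nonneg_left (Real.log_le_log hpos hle) hL0.le
  have hprodQ : ∏ j, α j ^ b j = ∏ x ∈ S, (x : ℚ) ^ e x := hreidx (fun x => (x : ℚ) ^ e x)
  have h7 : b ≠ 0 := by
    intro h0
    apply hne1
    rw [← hprodQ]
    exact Finset.prod_eq_one fun j _ => by rw [show b j = 0 from congrFun h0 j, zpow_zero]
  have hB0 : 0 < Real.log B := Real.log_pos (by linarith)
  have hB1 : 1 ≤ Real.log B := by
    have h3 : (1 : ℝ) < Real.log 3 := by
      rw [Real.lt_log_iff_exp_lt (by norm_num)]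
      exact Real.exp_one_lt_d9.trans (by norm_num)
    exact h3.le.trans (Real.log_le_log (by norm_num) hB)
  have hWge : Real.log B ≤ W := by
    rw [hW]; exact le_mul_of_one_le_right hB0.le hL1.le
  have h8 : ∀ j, Real.log (max 3 (|b j| : ℝ)) ≤ W := by
    intro j
    have hle : max 3 (|b j| : ℝ) ≤ B := max_le hB (by simp only [hb]; exact heB _ (hqS j))
    exact (Real.log_le_log (lt_of_lt_of_le (by norm_num) (le_max_left _ _)) hle).trans hWge
  have h9 : Real.log p ≤ W := by
    rw [hW, ← hL]; exact le_mul_of_one_le_left hL0.le hB1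
  -- the engine
  have key := hA p hp hPp m α b V Vmax W h1 h2 h3 h4 h5 h6 h7 h8 h9
  rw [hprodQ] at key
  -- `∏ Vⱼ / log p = ∏_{q ∈ S} log (max 4 q)`
  set PL : ℝ := ∏ x ∈ S, Real.log ((max 4 x : ℕ) : ℝ) with hPL
  have hPV : ∏ j, V j / Real.log p = PL := by
    rw [hPL, ← hreidx (fun x => Real.log ((max 4 x : ℕ) : ℝ))]
    refine Finset.prod_congr rfl fun j _ => ?_
    simp only [hV]
    rw [← hL]
    field_simp
  have hPL0 : 0 < PL := Finset.prod_pos fun x _ => by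
    linarith [(loglog_max_four_bounds x).1]
  have hW0 : 0 < W := by rw [hW]; exact mul_pos hB0 hL0
  have hlX0 : 0 < Real.log X := by linarith
  -- the garbage: `log(2Vmax) ≤ L(1 + log X)` and `W + log(2Vmax) ≤ 2L(log B + log X)`
  have hVmax0 : 0 < Vmax := by rw [hVmax]; exact mul_pos hL0 hX0
  have hlog2V : Real.log (2 * Vmax) ≤ L + Real.log X := by
    rw [hVmax, show 2 * (L * X) = 2 * L * X by ring, Real.log_mul (by positivity) hX0.ne',
      Real.log_mul (by norm_num) hL0.ne']
    have hlogL : Real.log L ≤ L - 1 := Real.log_le_sub_one_of_pos hL0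
    have hlog2 : Real.log 2 ≤ 1 := by have := Real.log_two_lt_d9; linarith
    linarith
  have hlog2V0 : 0 ≤ Real.log (2 * Vmax) := by
    apply Real.log_nonneg
    rw [hVmax]
    have : (1 : ℝ) ≤ L * X := by nlinarith
    linarith
  have hG1 : Real.log (2 * Vmax) ≤ L * (1 + Real.log X) := by
    have : L + Real.log X ≤ L * (1 + Real.log X) := by nlinarith
    exact hlog2V.trans this
  have hG2 : W + Real.log (2 * Vmax) ≤ 2 * L * (Real.log B + Real.log X) := by
    rw [hW]
    have : Real.log B * L + (L + Real.log X) ≤ 2 * L * (Real.log B + Real.log X) := by nlinarith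
    linarith
  have hG3 : 1 + Real.log X ≤ 5 * Real.log X := by linarith
  have hgarb : (W + Real.log (2 * Vmax)) * Real.log (2 * Vmax) ≤
      10 * L ^ 2 * ((Real.log B + Real.log X) * Real.log X) := by
    have h01 : 0 ≤ W + Real.log (2 * Vmax) := by linarith
    calc (W + Real.log (2 * Vmax)) * Real.log (2 * Vmax)
        ≤ (2 * L * (Real.log B + Real.log X)) * (L * (1 + Real.log X)) :=
          mul_le_mul hG2 hG1 hlog2V0 (by positivity)
      _ ≤ (2 * L * (Real.log B + Real.log X)) * (L * (5 * Real.log X)) := by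
          apply mul_le_mul_of_nonneg_left _ (by positivity)
          exact mul_le_mul_of_nonneg_left hG3 hL0.le
      _ = 10 * L ^ 2 * ((Real.log B + Real.log X) * Real.log X) := by ring
  have hL2p : L ^ 2 ≤ 4 * (p : ℝ) := by
    rw [hL]; exact Literature.NumberTheory.Transcendental.log_sq_le_four_mul (by linarith)
  -- assemble: `v ≤ C p PL (W+L2V) L2V ≤ C p PL 10 L² Q ≤ 40 C p² PL Q < (41 c₁ m)^m p² Q PL`
  set Q : ℝ := (Real.log B + Real.log X) * Real.log X with hQ
  have hQ0 : 0 < Q := by rw [hQ]; exact mul_pos (by linarith) hlX0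
  set v : ℝ := (padicValRat p (∏ x ∈ S, (x : ℚ) ^ e x - 1) : ℝ) with hv
  have hCm := hC m hm1
  have hstep1 : v ≤ C m * p * PL * (10 * L ^ 2 * Q) := by
    have h0 : 0 ≤ C m * p * PL := mul_nonneg (mul_nonneg hCm.1 hpR0.le) hPL0.le
    calc v ≤ C m * p * (∏ j, V j / Real.log p) * (W + Real.log (2 * Vmax)) * Real.log (2 * Vmax) := key
      _ = C m * p * PL * ((W + Real.log (2 * Vmax)) * Real.log (2 * Vmax)) := by rw [hPV]; ring
      _ ≤ C m * p * PL * (10 * L ^ 2 * Q) := mul_le_mul_of_nonneg_left hgarb h0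
  have hstep2 : C m * p * PL * (10 * L ^ 2 * Q) ≤ 40 * (c₁ ^ m * (m : ℝ) ^ m) * ((p : ℝ) ^ 2 * Q * PL) := by
    have h1 : C m * p * PL * (10 * L ^ 2 * Q) = (C m) * (L ^ 2) * (10 * p * Q * PL) := by ring
    have h2 : 40 * (c₁ ^ m * (m : ℝ) ^ m) * ((p : ℝ) ^ 2 * Q * PL) =
        (c₁ ^ m * (m : ℝ) ^ m) * (4 * p) * (10 * p * Q * PL) := by ring
    rw [h1, h2]
    have h0 : 0 ≤ 10 * (p : ℝ) * Q * PL := by positivity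
    exact mul_le_mul_of_nonneg_right (mul_le_mul hCm.2 hL2p (by positivity) (by positivity)) h0
  have henv : 40 * (c₁ ^ m * (m : ℝ) ^ m) < (41 * c₁ * m) ^ m := by
    have hm0 : (0 : ℝ) < (m : ℝ) ^ m := by
      have : (0 : ℝ) < m := by exact_mod_cast hm1
      positivity
    have hc0 : 0 < c₁ ^ m := by positivity
    have h41 : (40 : ℝ) < 41 ^ m := by
      calc (40 : ℝ) < 41 := by norm_num
        _ = 41 ^ 1 := (pow_one _).symm
        _ ≤ 41 ^ m := pow_le_pow_right₀ (by norm_num) hm1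
    calc 40 * (c₁ ^ m * (m : ℝ) ^ m) < 41 ^ m * (c₁ ^ m * (m : ℝ) ^ m) :=
          mul_lt_mul_of_pos_right h41 (mul_pos hc0 hm0)
      _ = (41 * c₁ * m) ^ m := by rw [mul_pow, mul_pow]; ring
  calc v ≤ C m * p * PL * (10 * L ^ 2 * Q) := hstep1
    _ ≤ 40 * (c₁ ^ m * (m : ℝ) ^ m) * ((p : ℝ) ^ 2 * Q * PL) := hstep2
    _ < (41 * c₁ * m) ^ m * ((p : ℝ) ^ 2 * Q * PL) :=
        mul_lt_mul_of_pos_right henv (mul_pos (mul_pos (pow_pos hpR0 2) hQ0) hPL0)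
    _ = (41 * c₁ * m) ^ m * (p : ℝ) ^ 2 * Q * PL := by ring

end YuNinetyW80

end Summit.ABC.StewartYu

end
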